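import Summits.CriticalPhenomena.CardyFormulaZ2.Theorems.CardyFlipRussoVoronoiHubFromSmirnovTelescope
import Summits.CriticalPhenomena.CardyFormulaZ2.Theorems.CardyFlipRussoVoronoiHubFromSmirnovLawBWIndependence
import Summits.CriticalPhenomena.CardyFormulaZ2.Theorems.CardyFlipRussoVoronoiHubFromSmirnovArmLoc
import Mathlib
import HarnessLib

/-!
# Stubs `stepBad_measure_le_R`, `stepBad_measure_le` (Core-C of the one-arm route) of line
# `moebius-exact-delaunay-dilation-ward` (crux `VoronoiHubFromSmirnov`, stmt-CriticalPhenomena-6433)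

THE PROBABILITY OF ONE TELESCOPING STEP.  The deterministic bad event `stepBad T u R W g V δ K i`
of the square `i` (landed module `…Telescope`: a defect pair in the square and one of five
alternatives — three single chain arms around the square, a chain arm split by ONE other
defective square `j`, or TWO separated defective squares `j, j'` in range) satisfies, on an
abstract good event, `μ(stepBad i ∩ good) ≤ 3 p B + N p² B + N² p³`, `μ = lawBW volume`,
`B = (Ca + v + 1)² ((400u/R)^η + v)`, `N = (2(R + 2u)/u + 1)²`, given abstract LOCAL supersets
of the defect events (`DefLoc k`, read on the disc `closedBall (sqCentre u k) ρD`, `ρD ≤ 10u`,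
probability `≤ p`) and of the chain-arm events (`Arm r₁ r₂`, read on the band
`r₁ - 4u ≤ dist · (sqCentre u i) ≤ r₂ + 4u`, probability `≤ Ca (r₁/r₂)^η + v`; only outer radii
`r₂ ≤ R` are needed: `stepBad_measure_le_R`, of which `stepBad_measure_le` is a weakening).

Proof.  (0) `stepBad i ∩ good` is covered by three sets `DefLoc i ∩ Arm r₁ r₂`, by
`⋃ⱼ DefLoc i ∩ DefLoc j ∩ Arm (100u) (dⱼ - 40u) ∩ Arm (dⱼ + 40u) R` and by
`⋃_{j,j'} DefLoc i ∩ DefLoc j ∩ DefLoc j'`.  (1) Each intersection is a PRODUCT of probabilities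
(landed product rule `lawBW_iInter_restrict_eq_prod` for events localised on disjoint regions,
through a four-fold wrapper; fewer factors by padding with the empty region).  (2) Arm factors:
monotonicity of `x ↦ x ^ η` and `(100u/(d-40u)) ((d+40u)/R) ≤ 400u/R` for `d ≥ 278u`.
(3) At most `N` squares `j` have `dist (sqCentre u j) (sqCentre u i) ≤ R + 2u` (box count in
`ℤ²`); finite subadditivity of the outer measure finishes.

References: I. Benjamini, O. Schramm, Comm. Math. Phys. 197 (1998) §§5–9; V. Tassion, Ann. Probab.
44 (2016) Thm 3.  No new definitions; tree facts and Mathlib only.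
-/

noncomputable section

namespace Summit.CriticalPhenomena.CardyFormulaZ2.Cruxes.VoronoiHubFromSmirnov.MoebiusExactDelaunayDilationWard

open Set MeasureTheory Metric
open Literature.Analysis.FunctionSpaces

/-! ### The product rule for four localised events -/

/-- **Four-fold product rule**: events localised on four pairwise disjoint measurable regions
(preimages of measurable sets under pair-restriction) are independent under `lawBW volume`
(the landed `lawBW_iInter_restrict_eq_prod` with `n = 4`). -/
theorem sbm_prod_four {D₀ D₁ D₂ D₃ : Set ℂ} (hD₀ : MeasurableSet D₀) (hD₁ : MeasurableSet D₁)
    (hD₂ : MeasurableSet D₂) (hD₃ : MeasurableSet D₃) (h01 : Disjoint D₀ D₁)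
    (h02 : Disjoint D₀ D₂) (h03 : Disjoint D₀ D₃) (h12 : Disjoint D₁ D₂) (h13 : Disjoint D₁ D₃)
    (h23 : Disjoint D₂ D₃) {S₀ S₁ S₂ S₃ : Set (PointConfig ℂ × PointConfig ℂ)}
    (h₀ : ∃ A, MeasurableSet A ∧
      S₀ = (fun c : PointConfig ℂ × PointConfig ℂ => (c.1.restrict D₀, c.2.restrict D₀)) ⁻¹' A)
    (h₁ : ∃ A, MeasurableSet A ∧
      S₁ = (fun c : PointConfig ℂ × PointConfig ℂ => (c.1.restrict D₁, c.2.restrict D₁)) ⁻¹' A)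
    (h₂ : ∃ A, MeasurableSet A ∧
      S₂ = (fun c : PointConfig ℂ × PointConfig ℂ => (c.1.restrict D₂, c.2.restrict D₂)) ⁻¹' A)
    (h₃ : ∃ A, MeasurableSet A ∧
      S₃ = (fun c : PointConfig ℂ × PointConfig ℂ => (c.1.restrict D₃, c.2.restrict D₃)) ⁻¹' A) :
    (lawBW volume).real (S₀ ∩ S₁ ∩ S₂ ∩ S₃) = (lawBW volume).real S₀ * (lawBW volume).real S₁ *
      (lawBW volume).real S₂ * (lawBW volume).real S₃ := by
  obtain ⟨⟨A₀, hA₀, rfl⟩, ⟨A₁, hA₁, rfl⟩, ⟨A₂, hA₂, rfl⟩, ⟨A₃, hA₃, rfl⟩⟩ :=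
    And.intro h₀ (And.intro h₁ (And.intro h₂ h₃))
  have hdisj : Pairwise (Function.onFun Disjoint ![D₀, D₁, D₂, D₃]) := fun a b hab => by
    fin_cases a <;> fin_cases b <;>
      simp_all [Function.onFun, h01.symm, h02.symm, h03.symm, h12.symm, h13.symm, h23.symm]
  have key := lawBW_iInter_restrict_eq_prod volume (fun x => measure_singleton x) 4
    ![D₀, D₁, D₂, D₃] (fun k => by fin_cases k <;> simp [hD₀, hD₁, hD₂, hD₃]) hdisj
    ![A₀, A₁, A₂, A₃] (fun k => by fin_cases k <;> simp [hA₀, hA₁, hA₂, hA₃])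
  simp only [Set.iInter_setOf, Fin.forall_fin_succ, IsEmpty.forall_iff, and_true,
    Fin.prod_univ_four, Matrix.cons_val_zero, Matrix.cons_val_succ, Set.setOf_and,
    ← Set.inter_assoc] at key
  simp only [measureReal_def]
  rw [← ENNReal.toReal_mul, ← ENNReal.toReal_mul, ← ENNReal.toReal_mul]
  exact congrArg ENNReal.toReal key

/-- The sure event is localised on the empty region. -/
theorem sbm_loc_univ : ∃ A : Set (PointConfig ℂ × PointConfig ℂ), MeasurableSet A ∧
    (univ : Set (PointConfig ℂ × PointConfig ℂ)) =
      (fun c : PointConfig ℂ × PointConfig ℂ => (c.1.restrict ∅, c.2.restrict ∅)) ⁻¹' A :=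
  ⟨univ, MeasurableSet.univ, Set.preimage_univ.symm⟩

/-! ### Disjointness and measurability of the regions -/

/-- The band `{a ≤ dist · z ≤ b}` is measurable. -/
theorem sbm_measurableSet_band (z : ℂ) (a b : ℝ) :
    MeasurableSet {x : ℂ | a ≤ dist x z ∧ dist x z ≤ b} := by
  have hc : Continuous fun x : ℂ => dist x z := continuous_id.dist continuous_const
  rw [Set.setOf_and]
  exact ((isClosed_le continuous_const hc).inter (isClosed_le hc continuous_const)).measurableSet

/-- A small disc around `w` misses a band around `z` ending strictly inside `dist w z - ρ`. -/
theorem sbm_disjoint_ball_band_of_lt {z w : ℂ} {ρ a b : ℝ} (h : b < dist w z - ρ) :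
    Disjoint (closedBall w ρ) {x : ℂ | a ≤ dist x z ∧ dist x z ≤ b} :=
  Set.disjoint_left.2 fun x hx hx' => by
    linarith [mem_closedBall.1 hx, hx'.2, dist_triangle w x z, dist_comm w x]

/-- A small disc around `w` misses a band around `z` starting strictly beyond `dist w z + ρ`. -/
theorem sbm_disjoint_ball_band_of_gt {z w : ℂ} {ρ a b : ℝ} (h : dist w z + ρ < a) :
    Disjoint (closedBall w ρ) {x : ℂ | a ≤ dist x z ∧ dist x z ≤ b} :=
  Set.disjoint_left.2 fun x hx hx' => by linarith [mem_closedBall.1 hx, hx'.1, dist_triangle x w z]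

/-- Two bands around `z` with separated radii are disjoint. -/
theorem sbm_disjoint_band_band {z : ℂ} {a b a' b' : ℝ} (h : b < a') :
    Disjoint {x : ℂ | a ≤ dist x z ∧ dist x z ≤ b} {x : ℂ | a' ≤ dist x z ∧ dist x z ≤ b'} :=
  Set.disjoint_left.2 fun x hx hx' => by linarith [hx.2, hx'.1]

/-! ### Elementary real estimates -/

/-- Single-arm bookkeeping: `Ca x^η + v ≤ (Ca + v + 1)² (X^η + v)` for `0 ≤ x ≤ X`. -/
theorem sbm_arm_le {Ca v x X η m : ℝ} (hCa : 0 ≤ Ca) (hv : 0 ≤ v) (hx : 0 ≤ x) (hxX : x ≤ X)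
    (hη : 0 ≤ η) (hm : m ≤ Ca * x ^ η + v) : m ≤ (Ca + v + 1) ^ 2 * (X ^ η + v) := by
  have he : 0 ≤ X ^ η := Real.rpow_nonneg (hx.trans hxX) η
  have h2 : Ca * x ^ η ≤ Ca * X ^ η := mul_le_mul_of_nonneg_left (Real.rpow_le_rpow hx hxX hη) hCa
  nlinarith [mul_nonneg (mul_nonneg hCa hCa) he, mul_nonneg (mul_nonneg hv hv) he,
    mul_nonneg (mul_nonneg hCa hv) he, mul_nonneg hCa he, mul_nonneg hv he,
    mul_nonneg (mul_nonneg hCa hCa) hv, mul_nonneg (mul_nonneg hv hv) hv,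
    mul_nonneg (mul_nonneg hCa hv) hv, mul_nonneg hCa hv, mul_nonneg hv hv]

/-- Split-arm bookkeeping: `(Ca x^η + v)(Ca y^η + v) ≤ (Ca + v + 1)² (X^η + v)` for
`x, y ∈ [0, 1]` with `x y ≤ X`. -/
theorem sbm_arm_pair_le {Ca v x y X η m₁ m₂ : ℝ} (hCa : 0 ≤ Ca) (hv : 0 ≤ v) (hx : 0 ≤ x)
    (hx1 : x ≤ 1) (hy : 0 ≤ y) (hy1 : y ≤ 1) (hX : x * y ≤ X) (hη : 0 ≤ η) (hm₂ : 0 ≤ m₂)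
    (h₁ : m₁ ≤ Ca * x ^ η + v) (h₂ : m₂ ≤ Ca * y ^ η + v) :
    m₁ * m₂ ≤ (Ca + v + 1) ^ 2 * (X ^ η + v) := by
  have hab : x ^ η * y ^ η ≤ X ^ η := by
    rw [← Real.mul_rpow hx hy]
    exact Real.rpow_le_rpow (mul_nonneg hx hy) hX hη
  have he : 0 ≤ X ^ η := (mul_nonneg (Real.rpow_nonneg hx η) (Real.rpow_nonneg hy η)).trans hab
  have hprod : m₁ * m₂ ≤ (Ca * x ^ η + v) * (Ca * y ^ η + v) :=
    mul_le_mul h₁ h₂ hm₂ (add_nonneg (mul_nonneg hCa (Real.rpow_nonneg hx η)) hv)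
  have hstep : (Ca * x ^ η + v) * (Ca * y ^ η + v) ≤ Ca ^ 2 * X ^ η + 2 * (Ca * v) + v ^ 2 := by
    have e1 : Ca * v * x ^ η ≤ Ca * v :=
      mul_le_of_le_one_right (mul_nonneg hCa hv) (Real.rpow_le_one hx hx1 hη)
    have e2 : Ca * v * y ^ η ≤ Ca * v :=
      mul_le_of_le_one_right (mul_nonneg hCa hv) (Real.rpow_le_one hy hy1 hη)
    have e3 : Ca ^ 2 * (x ^ η * y ^ η) ≤ Ca ^ 2 * X ^ η :=
      mul_le_mul_of_nonneg_left hab (sq_nonneg Ca)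
    nlinarith [e1, e2, e3]
  nlinarith [mul_nonneg (mul_nonneg hCa hCa) hv, mul_nonneg (mul_nonneg hv hv) he,
    mul_nonneg (mul_nonneg hv hv) hv, mul_nonneg (mul_nonneg hCa hv) he,
    mul_nonneg (mul_nonneg hCa hv) hv, mul_nonneg hCa he, mul_nonneg hv he, mul_nonneg hv hv]

/-! ### Counting squares in range -/

/-- **Box count**: the squares of side `u` whose centres are within `L` of the centre of the
square `i` number at most `(2L/u + 1)²`. -/
theorem sbm_card_le {u L : ℝ} (hu : 0 < u) (hL : 0 ≤ L) (i : ℤ × ℤ) (F : Finset (ℤ × ℤ))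
    (hF : ∀ j ∈ F, dist (sqCentre u j) (sqCentre u i) ≤ L) :
    (F.card : ℝ) ≤ (2 * L / u + 1) ^ 2 := by
  set M : ℤ := ⌊L / u⌋ with hM
  have hM0 : 0 ≤ M := Int.floor_nonneg.2 (div_nonneg hL hu.le)
  have hMle : (M : ℝ) ≤ L / u := Int.floor_le _
  have hsub : F ⊆ (Finset.Icc (i.1 - M) (i.1 + M)) ×ˢ (Finset.Icc (i.2 - M) (i.2 + M)) := by
    intro j hj
    have hd := hF j hj
    rw [dist_eq_norm] at hd
    have hre : (sqCentre u j - sqCentre u i).re = ((j.1 : ℝ) - i.1) * u := by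
      simp only [sqCentre, Complex.sub_re]; ring
    have him : (sqCentre u j - sqCentre u i).im = ((j.2 : ℝ) - i.2) * u := by
      simp only [sqCentre, Complex.sub_im]; ring
    have h1 := Complex.abs_re_le_norm (sqCentre u j - sqCentre u i)
    have h2 := Complex.abs_im_le_norm (sqCentre u j - sqCentre u i)
    rw [hre, abs_mul, abs_of_pos hu] at h1
    rw [him, abs_mul, abs_of_pos hu] at h2
    have h1' : |j.1 - i.1| ≤ M := by
      rw [hM, Int.le_floor, le_div_iff₀ hu]; push_cast; linarith
    have h2' : |j.2 - i.2| ≤ M := by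
      rw [hM, Int.le_floor, le_div_iff₀ hu]; push_cast; linarith
    rw [abs_le] at h1' h2'
    simp only [Finset.mem_product, Finset.mem_Icc]
    omega
  have hcard := (Finset.card_le_card hsub).trans_eq (Finset.card_product _ _)
  have hIcc : ∀ a : ℤ, ((Finset.Icc (a - M) (a + M)).card : ℝ) = 2 * M + 1 := by
    intro a
    have h := Int.card_Icc_of_le (a := a - M) (b := a + M) (by linarith)
    have e : ((Finset.Icc (a - M) (a + M)).card : ℝ) =
        (((Finset.Icc (a - M) (a + M)).card : ℤ) : ℝ) := by push_cast; rfl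
    rw [e, h]; push_cast; ring
  have hM0' : (0 : ℝ) ≤ M := by exact_mod_cast hM0
  calc (F.card : ℝ)
      ≤ ((Finset.Icc (i.1 - M) (i.1 + M)).card * (Finset.Icc (i.2 - M) (i.2 + M)).card : ℕ) := by
        exact_mod_cast hcard
    _ = (2 * M + 1) * (2 * M + 1) := by push_cast; rw [hIcc, hIcc]
    _ ≤ (2 * L / u + 1) ^ 2 := by
        have h1 : 2 * (M : ℝ) + 1 ≤ 2 * L / u + 1 := by rw [mul_div_assoc]; linarith
        nlinarith

/-! ### The step bound -/

set_option maxHeartbeats 400000 in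
/-- **Core-C of the one-arm route: the probability of one telescoping step.**  With abstract local
supersets `DefLoc k` (on the discs `closedBall (sqCentre u k) ρD`, probability `≤ p`) of the defect
events and `Arm r₁ r₂` (on the bands `r₁ - 4u ≤ dist · (sqCentre u i) ≤ r₂ + 4u`, `r₂ ≤ R`,
probability `≤ Ca (r₁/r₂)^η + v`) of the chain-arm events around the square `i`, valid on `good`,
`μ(stepBad i ∩ good) ≤ 3 p B + N p² B + N² p³` (`μ = lawBW volume`,
`B = (Ca + v + 1)² ((400u/R)^η + v)`, `N = (2(R + 2u)/u + 1)²`): set inclusion, the product rule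
on disjoint regions, monotonicity of `x ↦ x^η`, a box count. -/
theorem stepBad_measure_le_R : ∀ (T : Finset (ℤ × ℤ)) (u R ρD p v Ca η : ℝ) (W : Set ℂ) (g : ℂ → ℂ) (V : Set ℂ) (δ : ℝ) (K : Set ℂ) (good : Set (Literature.Analysis.FunctionSpaces.PointConfig ℂ × Literature.Analysis.FunctionSpaces.PointConfig ℂ)) (DefLoc : ℤ × ℤ → Set (Literature.Analysis.FunctionSpaces.PointConfig ℂ × Literature.Analysis.FunctionSpaces.PointConfig ℂ)) (ADef : ℤ × ℤ → Set (Literature.Analysis.FunctionSpaces.PointConfig ℂ × Literature.Analysis.FunctionSpaces.PointConfig ℂ)) (Arm : ℝ → ℝ → Set (Literature.Analysis.FunctionSpaces.PointConfig ℂ × Literature.Analysis.FunctionSpaces.PointConfig ℂ)) (AArm : ℝ → ℝ → Set (Literature.Analysis.FunctionSpaces.PointConfig ℂ × Literature.Analysis.FunctionSpaces.PointConfig ℂ)) (i : ℤ × ℤ), 0 < u → 400 * u < R → 0 ≤ ρD → ρD ≤ 10 * u → 0 ≤ p → 0 ≤ v → 0 ≤ Ca → 0 < η → i ∈ T → (∀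 k ∈ T, {c | DefSq (adjEuc W c) (adjPull g V δ c) u k K δ (c.1 : Set ℂ)} ∩ good ⊆ DefLoc k) → (∀ r₁ r₂ : ℝ, 100 * u ≤ r₁ → r₁ < r₂ → r₂ ≤ R → {c | ChainArm (adjEuc W c) (sqCentre u i) r₁ r₂ K δ (c.1 : Set ℂ)} ∩ good ⊆ Arm r₁ r₂) → (∀ k ∈ T, MeasurableSet (ADef k) ∧ DefLoc k = (fun c : Literature.Analysis.FunctionSpaces.PointConfig ℂ × Literature.Analysis.FunctionSpaces.PointConfig ℂ => (Literature.Analysis.FunctionSpaces.PointConfig.restrict (Metric.closedBall (sqCentre u k) ρD) c.1, Literature.Analysis.FunctionSpaces.PointConfig.restrict (Metric.closedBall (sqCentre u k) ρD) c.2)) ⁻¹' ADef k) → (∀ r₁ r₂ : ℝ, MeasurableSet (AArm r₁ r₂) ∧ Arm r₁ r₂ = (fun c : Literature.Analysis.FunctionSpaces.PointConfig ℂ × Literature.Analysis.FunctionSpaces.PointConfig ℂ => (Literature.Analysis.FunctionSpaces.PointConfig.restrict {x : ℂ | r₁ - 4 * u ≤ dist x (sqCentre u i) ∧ dist x (sqCentre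 u i) ≤ r₂ + 4 * u} c.1, Literature.Analysis.FunctionSpaces.PointConfig.restrict {x : ℂ | r₁ - 4 * u ≤ dist x (sqCentre u i) ∧ dist x (sqCentre u i) ≤ r₂ + 4 * u} c.2)) ⁻¹' AArm r₁ r₂) → (∀ k ∈ T, (lawBW (MeasureTheory.volume : MeasureTheory.Measure ℂ)).real (DefLoc k) ≤ p) → (∀ r₁ r₂ : ℝ, 100 * u ≤ r₁ → r₁ < r₂ → r₂ ≤ R → (lawBW (MeasureTheory.volume : MeasureTheory.Measure ℂ)).real (Arm r₁ r₂) ≤ Ca * (r₁ / r₂) ^ η + v) → (lawBW (MeasureTheory.volume : MeasureTheory.Measure ℂ)).real (stepBad T u R W g V δ K i ∩ good) ≤ 3 * p * ((Ca + v + 1) ^ 2 * ((400 * u / R) ^ η + v)) + (2 * (R + 2 * u) / u + 1) ^ 2 * p ^ 2 * ((Ca + v + 1) ^ 2 * ((400 * u / R) ^ η + v)) + ((2 * (R + 2 * u) / u + 1) ^ 2) ^ 2 * p ^ 3 := by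
  intro T u R ρD p v Ca η W g V δ K good DefLoc ADef Arm AArm i hu hR hρD hρD10 hp hv hCa hη hi
    hDef hArm hDefLoc hArmLoc hpB haB
  classical
  haveI : IsProbabilityMeasure (lawBW (volume : Measure ℂ)) := isProbabilityMeasure_lawBW_volume
  have hR0 : 0 < R := by linarith
  set B : ℝ := (Ca + v + 1) ^ 2 * ((400 * u / R) ^ η + v) with hB
  set N : ℝ := (2 * (R + 2 * u) / u + 1) ^ 2 with hN
  have hB0 : 0 ≤ B := by rw [hB]; positivity
  -- the localisation data, packaged
  have hLD : ∀ k ∈ T, ∃ A, MeasurableSet A ∧ DefLoc k =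
      (fun c : PointConfig ℂ × PointConfig ℂ => (c.1.restrict (closedBall (sqCentre u k) ρD),
        c.2.restrict (closedBall (sqCentre u k) ρD))) ⁻¹' A :=
    fun k hk => ⟨ADef k, (hDefLoc k hk).1, (hDefLoc k hk).2⟩
  have hLA : ∀ r₁ r₂ : ℝ, ∃ A, MeasurableSet A ∧ Arm r₁ r₂ =
      (fun c : PointConfig ℂ × PointConfig ℂ =>
        (c.1.restrict {x : ℂ | r₁ - 4 * u ≤ dist x (sqCentre u i) ∧
            dist x (sqCentre u i) ≤ r₂ + 4 * u},
          c.2.restrict {x : ℂ | r₁ - 4 * u ≤ dist x (sqCentre u i) ∧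
            dist x (sqCentre u i) ≤ r₂ + 4 * u})) ⁻¹' A :=
    fun r₁ r₂ => ⟨AArm r₁ r₂, (hArmLoc r₁ r₂).1, (hArmLoc r₁ r₂).2⟩
  -- (1)+(2) for a single arm: `μ(DefLoc i ∩ Arm r₁ r₂) ≤ p B` when `r₁ / r₂ ≤ 400u / R`
  have hsingle : ∀ r₁ r₂ : ℝ, 100 * u ≤ r₁ → r₁ < r₂ → r₂ ≤ R → r₁ * R ≤ 400 * u * r₂ →
      (lawBW volume).real (DefLoc i ∩ Arm r₁ r₂) ≤ p * B := by
    intro r₁ r₂ hr₁ hr₁₂ hr₂ hratio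
    have hratio' : r₁ / r₂ ≤ 400 * u / R := by rw [div_le_div_iff₀ (by linarith) hR0]; linarith
    have key := sbm_prod_four measurableSet_closedBall (sbm_measurableSet_band _ _ _)
      MeasurableSet.empty MeasurableSet.empty
      (sbm_disjoint_ball_band_of_gt (by rw [dist_self]; linarith)) (Set.disjoint_empty _)
      (Set.disjoint_empty _) (Set.disjoint_empty _) (Set.disjoint_empty _) (Set.disjoint_empty _)
      (hLD i hi) (hLA r₁ r₂) sbm_loc_univ sbm_loc_univ
    simp only [Set.inter_univ, probReal_univ, mul_one] at key
    rw [key]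
    exact mul_le_mul (hpB i hi) (sbm_arm_le hCa hv (div_nonneg (by linarith) (by linarith))
      hratio' hη.le (haB r₁ r₂ hr₁ hr₁₂ hr₂)) measureReal_nonneg hp
  -- (1)+(2) for a split arm
  have hsplit : ∀ j ∈ T, 278 * u ≤ dist (sqCentre u j) (sqCentre u i) →
      dist (sqCentre u j) (sqCentre u i) ≤ R - 178 * u →
      (lawBW volume).real (DefLoc i ∩ DefLoc j ∩
        Arm (100 * u) (dist (sqCentre u j) (sqCentre u i) - 40 * u) ∩
        Arm (dist (sqCentre u j) (sqCentre u i) + 40 * u) R) ≤ p ^ 2 * B := by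
    intro j hj hd1 hd2
    rw [sbm_prod_four measurableSet_closedBall measurableSet_closedBall
      (sbm_measurableSet_band _ _ _) (sbm_measurableSet_band _ _ _)
      (closedBall_disjoint_closedBall (by rw [dist_comm]; linarith))
      (sbm_disjoint_ball_band_of_gt (by rw [dist_self]; linarith))
      (sbm_disjoint_ball_band_of_gt (by rw [dist_self]; linarith))
      (sbm_disjoint_ball_band_of_lt (by linarith)) (sbm_disjoint_ball_band_of_gt (by linarith))
      (sbm_disjoint_band_band (by linarith)) (hLD i hi) (hLD j hj)
      (hLA (100 * u) (dist (sqCentre u j) (sqCentre u i) - 40 * u))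
      (hLA (dist (sqCentre u j) (sqCentre u i) + 40 * u) R)]
    set d : ℝ := dist (sqCentre u j) (sqCentre u i) with hd
    have hd40 : 0 < d - 40 * u := by linarith
    have hx1 : 100 * u / (d - 40 * u) ≤ 1 := by rw [div_le_one hd40]; linarith
    have hy1 : (d + 40 * u) / R ≤ 1 := by rw [div_le_one hR0]; linarith
    have hxy : 100 * u / (d - 40 * u) * ((d + 40 * u) / R) ≤ 400 * u / R := by
      rw [div_mul_div_comm, div_le_div_iff₀ (mul_pos hd40 hR0) hR0]
      have h1 : 0 ≤ u * (300 * d - 20000 * u) := mul_nonneg hu.le (by linarith)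
      nlinarith [mul_nonneg h1 hR0.le]
    have hpair := sbm_arm_pair_le hCa hv (div_nonneg (by linarith) hd40.le) hx1
      (div_nonneg (by linarith) hR0.le) hy1 hxy hη.le measureReal_nonneg
      (haB (100 * u) (d - 40 * u) le_rfl (by linarith) (by linarith))
      (haB (d + 40 * u) R (by linarith) (by linarith) le_rfl)
    have hpp : (lawBW volume).real (DefLoc i) * (lawBW volume).real (DefLoc j) ≤ p ^ 2 := by
      rw [sq]; exact mul_le_mul (hpB i hi) (hpB j hj) measureReal_nonneg hp
    linarith [mul_le_mul hpp hpair (mul_nonneg measureReal_nonneg measureReal_nonneg) (sq_nonneg p)]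
  -- (1)+(2) for two separated defective squares
  have htwo : ∀ j ∈ T, ∀ j' ∈ T, 20 * u < dist (sqCentre u j) (sqCentre u j') →
      98 * u ≤ dist (sqCentre u j) (sqCentre u i) → 98 * u ≤ dist (sqCentre u j') (sqCentre u i) →
      (lawBW volume).real (DefLoc i ∩ DefLoc j ∩ DefLoc j') ≤ p ^ 3 := by
    intro j hj j' hj' hjj' hdj hdj'
    have key := sbm_prod_four measurableSet_closedBall measurableSet_closedBall
      measurableSet_closedBall MeasurableSet.empty
      (closedBall_disjoint_closedBall (by rw [dist_comm]; linarith))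
      (closedBall_disjoint_closedBall (by rw [dist_comm]; linarith)) (Set.disjoint_empty _)
      (closedBall_disjoint_closedBall (by linarith)) (Set.disjoint_empty _) (Set.disjoint_empty _)
      (hLD i hi) (hLD j hj) (hLD j' hj') sbm_loc_univ
    simp only [Set.inter_univ, probReal_univ, mul_one] at key
    rw [key]
    have key' := mul_le_mul (mul_le_mul (hpB i hi) (hpB j hj) measureReal_nonneg hp) (hpB j' hj')
      measureReal_nonneg (mul_nonneg hp hp)
    nlinarith
  -- (3) the index sets of the unions and the counting of squares in range
  obtain ⟨F4, hF4⟩ : ∃ F4 : Finset (ℤ × ℤ), F4 = T.filter (fun j =>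
      278 * u ≤ dist (sqCentre u j) (sqCentre u i) ∧
        dist (sqCentre u j) (sqCentre u i) ≤ R - 178 * u) := ⟨_, rfl⟩
  obtain ⟨F5, hF5⟩ : ∃ F5 : Finset ((ℤ × ℤ) × (ℤ × ℤ)), F5 = (T ×ˢ T).filter (fun jj =>
      20 * u < dist (sqCentre u jj.1) (sqCentre u jj.2) ∧
        98 * u ≤ dist (sqCentre u jj.1) (sqCentre u i) ∧
        dist (sqCentre u jj.1) (sqCentre u i) ≤ R + 2 * u ∧
        98 * u ≤ dist (sqCentre u jj.2) (sqCentre u i) ∧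
        dist (sqCentre u jj.2) (sqCentre u i) ≤ R + 2 * u) := ⟨_, rfl⟩
  obtain ⟨TR, hTR⟩ : ∃ TR : Finset (ℤ × ℤ),
      TR = T.filter (fun j => dist (sqCentre u j) (sqCentre u i) ≤ R + 2 * u) := ⟨_, rfl⟩
  have hTRN : (TR.card : ℝ) ≤ N := sbm_card_le (L := R + 2 * u) hu (by linarith) i TR
    fun j hj => by rw [hTR, Finset.mem_filter] at hj; exact hj.2
  have c4 : (F4.card : ℝ) ≤ N := sbm_card_le (L := R + 2 * u) hu (by linarith) i F4
    fun j hj => by rw [hF4, Finset.mem_filter] at hj; linarith [hj.2.2]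
  have c5 : (F5.card : ℝ) ≤ N ^ 2 := by
    have h1 : F5.card ≤ TR.card * TR.card := by
      rw [← Finset.card_product]
      refine Finset.card_le_card fun jj hjj => ?_
      rw [hF5, Finset.mem_filter, Finset.mem_product] at hjj
      rw [Finset.mem_product, hTR, Finset.mem_filter, Finset.mem_filter]
      exact ⟨⟨hjj.1.1, hjj.2.2.2.1⟩, ⟨hjj.1.2, hjj.2.2.2.2.2⟩⟩
    have h2 : (F5.card : ℝ) ≤ TR.card * TR.card := by exact_mod_cast h1
    rw [sq]
    exact h2.trans (mul_le_mul hTRN hTRN (Nat.cast_nonneg _) ((Nat.cast_nonneg _).trans hTRN))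
  -- the five families of events
  set E1 : Set (PointConfig ℂ × PointConfig ℂ) := DefLoc i ∩ Arm (100 * u) R with hE1
  set E2 : Set (PointConfig ℂ × PointConfig ℂ) := DefLoc i ∩ Arm (300 * u) R with hE2
  set E3 : Set (PointConfig ℂ × PointConfig ℂ) := DefLoc i ∩ Arm (100 * u) (R - 200 * u) with hE3
  set E4 : ℤ × ℤ → Set (PointConfig ℂ × PointConfig ℂ) := fun j => DefLoc i ∩ DefLoc j ∩
      Arm (100 * u) (dist (sqCentre u j) (sqCentre u i) - 40 * u) ∩
      Arm (dist (sqCentre u j) (sqCentre u i) + 40 * u) R with hE4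
  set E5 : (ℤ × ℤ) × (ℤ × ℤ) → Set (PointConfig ℂ × PointConfig ℂ) := fun jj =>
      DefLoc i ∩ DefLoc jj.1 ∩ DefLoc jj.2 with hE5
  -- (0) the set inclusion
  have hcover : stepBad T u R W g V δ K i ∩ good ⊆
      (E1 ∪ E2 ∪ E3 ∪ ⋃ j ∈ F4, E4 j) ∪ ⋃ jj ∈ F5, E5 jj := by
    rintro c ⟨⟨hdef, hcases⟩, hcg⟩
    have hDi : c ∈ DefLoc i := hDef i hi ⟨hdef, hcg⟩
    rcases hcases with h1 | h2 | h3 | ⟨j, hjT, hdefj, hdj1, hdj2, harm1, harm2⟩ |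
      ⟨j, hjT, j', hj'T, hdefj, hdefj', hjj', hdj1, hdj2, hdj'1, hdj'2⟩
    · refine Or.inl (Or.inl (Or.inl (Or.inl ?_)))
      rw [hE1]; exact ⟨hDi, hArm _ _ le_rfl (by linarith) le_rfl ⟨h1, hcg⟩⟩
    · refine Or.inl (Or.inl (Or.inl (Or.inr ?_)))
      rw [hE2]; exact ⟨hDi, hArm _ _ (by linarith) (by linarith) le_rfl ⟨h2, hcg⟩⟩
    · refine Or.inl (Or.inl (Or.inr ?_))
      rw [hE3]; exact ⟨hDi, hArm _ _ le_rfl (by linarith) (by linarith) ⟨h3, hcg⟩⟩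
    · refine Or.inl (Or.inr (Set.mem_iUnion₂.2 ⟨j, ?_, ?_⟩))
      · rw [hF4, Finset.mem_filter]; exact ⟨hjT, hdj1, hdj2⟩
      · rw [hE4]
        exact ⟨⟨⟨hDi, hDef j hjT ⟨hdefj, hcg⟩⟩,
          hArm _ _ le_rfl (by linarith) (by linarith) ⟨harm1, hcg⟩⟩,
          hArm _ _ (by linarith) (by linarith) le_rfl ⟨harm2, hcg⟩⟩
    · refine Or.inr (Set.mem_iUnion₂.2 ⟨(j, j'), ?_, ?_⟩)
      · rw [hF5, Finset.mem_filter, Finset.mem_product]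
        exact ⟨⟨hjT, hj'T⟩, hjj', hdj1, hdj2, hdj'1, hdj'2⟩
      · rw [hE5]; exact ⟨⟨hDi, hDef j hjT ⟨hdefj, hcg⟩⟩, hDef j' hj'T ⟨hdefj', hcg⟩⟩
  -- subadditivity and the bounds on the pieces
  have i0 : (lawBW volume).real (stepBad T u R W g V δ K i ∩ good) ≤
      (lawBW volume).real ((E1 ∪ E2 ∪ E3 ∪ ⋃ j ∈ F4, E4 j) ∪ ⋃ jj ∈ F5, E5 jj) :=
    measureReal_mono hcover
  have i1 := measureReal_union_le (μ := lawBW (volume : Measure ℂ))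
    (E1 ∪ E2 ∪ E3 ∪ ⋃ j ∈ F4, E4 j) (⋃ jj ∈ F5, E5 jj)
  have i2 := measureReal_union_le (μ := lawBW (volume : Measure ℂ)) (E1 ∪ E2 ∪ E3) (⋃ j ∈ F4, E4 j)
  have i3 := measureReal_union_le (μ := lawBW (volume : Measure ℂ)) (E1 ∪ E2) E3
  have i4 := measureReal_union_le (μ := lawBW (volume : Measure ℂ)) E1 E2
  have i5 := measureReal_biUnion_finset_le (μ := lawBW (volume : Measure ℂ)) F4 E4
  have i6 := measureReal_biUnion_finset_le (μ := lawBW (volume : Measure ℂ)) F5 E5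
  have b1 : (lawBW volume).real E1 ≤ p * B := by
    rw [hE1]; exact hsingle _ _ le_rfl (by linarith) le_rfl (by nlinarith [mul_pos hu hR0])
  have b2 : (lawBW volume).real E2 ≤ p * B := by
    rw [hE2]
    exact hsingle _ _ (by linarith) (by linarith) le_rfl (by nlinarith [mul_pos hu hR0])
  have b3 : (lawBW volume).real E3 ≤ p * B := by
    rw [hE3]; exact hsingle _ _ le_rfl (by linarith) (by linarith)
      (by nlinarith [mul_nonneg hu.le (by linarith : (0 : ℝ) ≤ 300 * R - 80000 * u)])
  have t4 : ∑ j ∈ F4, (lawBW volume).real (E4 j) ≤ N * (p ^ 2 * B) := by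
    refine le_trans (Finset.sum_le_card_nsmul F4 _ (p ^ 2 * B) fun j hj => ?_) ?_
    · rw [hF4, Finset.mem_filter] at hj
      rw [hE4]; exact hsplit j hj.1 hj.2.1 hj.2.2
    · rw [nsmul_eq_mul]; exact mul_le_mul_of_nonneg_right c4 (by positivity)
  have t5 : ∑ jj ∈ F5, (lawBW volume).real (E5 jj) ≤ N ^ 2 * p ^ 3 := by
    refine le_trans (Finset.sum_le_card_nsmul F5 _ (p ^ 3) fun jj hjj => ?_) ?_
    · rw [hF5, Finset.mem_filter, Finset.mem_product] at hjj
      rw [hE5]; exact htwo jj.1 hjj.1.1 jj.2 hjj.1.2 hjj.2.1 hjj.2.2.1 hjj.2.2.2.2.1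
    · rw [nsmul_eq_mul]; exact mul_le_mul_of_nonneg_right c5 (by positivity)
  linarith

/-- **Core-C, all-radii form**: `stepBad_measure_le_R` with the arm hypotheses assumed for all
outer radii (a weakening of `stepBad_measure_le_R`). -/
theorem stepBad_measure_le : ∀ (T : Finset (ℤ × ℤ)) (u R ρD p v Ca η : ℝ) (W : Set ℂ) (g : ℂ → ℂ) (V : Set ℂ) (δ : ℝ) (K : Set ℂ) (good : Set (Literature.Analysis.FunctionSpaces.PointConfig ℂ × Literature.Analysis.FunctionSpaces.PointConfig ℂ)) (DefLoc : ℤ × ℤ → Set (Literature.Analysis.FunctionSpaces.PointConfig ℂ × Literature.Analysis.FunctionSpaces.PointConfig ℂ)) (ADef : ℤ × ℤ → Set (Literature.Analysis.FunctionSpaces.PointConfig ℂ × Literature.Analysis.FunctionSpaces.PointConfig ℂ)) (Arm : ℝ → ℝ → Set (Literature.Analysis.FunctionSpaces.PointConfig ℂ × Literature.Analysis.FunctionSpaces.PointConfig ℂ)) (AArm : ℝ → ℝ → Set (Literature.Analysis.FunctionSpaces.PointConfig ℂ × Literature.Analysis.FunctionSpaces.PointConfig ℂ)) (i : ℤ ×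 ℤ), 0 < u → 400 * u < R → 0 ≤ ρD → ρD ≤ 10 * u → 0 ≤ p → 0 ≤ v → 0 ≤ Ca → 0 < η → i ∈ T → (∀ k ∈ T, {c | DefSq (adjEuc W c) (adjPull g V δ c) u k K δ (c.1 : Set ℂ)} ∩ good ⊆ DefLoc k) → (∀ r₁ r₂ : ℝ, 100 * u ≤ r₁ → r₁ < r₂ → {c | ChainArm (adjEuc W c) (sqCentre u i) r₁ r₂ K δ (c.1 : Set ℂ)} ∩ good ⊆ Arm r₁ r₂) → (∀ k ∈ T, MeasurableSet (ADef k) ∧ DefLoc k = (fun c : Literature.Analysis.FunctionSpaces.PointConfig ℂ × Literature.Analysis.FunctionSpaces.PointConfig ℂ => (Literature.Analysis.FunctionSpaces.PointConfig.restrict (Metric.closedBall (sqCentre u k) ρD) c.1, Literature.Analysis.FunctionSpaces.PointConfig.restrict (Metric.closedBall (sqCentre u k) ρD) c.2)) ⁻¹' ADef k) → (∀ r₁ r₂ : ℝ, MeasurableSet (AArm r₁ r₂) ∧ Arm r₁ r₂ = (fun c : Literature.Analysis.FunctionSpaces.PointConfig ℂ × Literature.Analysis.FunctionSpaces.PointConfig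 ℂ => (Literature.Analysis.FunctionSpaces.PointConfig.restrict {x : ℂ | r₁ - 4 * u ≤ dist x (sqCentre u i) ∧ dist x (sqCentre u i) ≤ r₂ + 4 * u} c.1, Literature.Analysis.FunctionSpaces.PointConfig.restrict {x : ℂ | r₁ - 4 * u ≤ dist x (sqCentre u i) ∧ dist x (sqCentre u i) ≤ r₂ + 4 * u} c.2)) ⁻¹' AArm r₁ r₂) → (∀ k ∈ T, (lawBW (MeasureTheory.volume : MeasureTheory.Measure ℂ)).real (DefLoc k) ≤ p) → (∀ r₁ r₂ : ℝ, 100 * u ≤ r₁ → r₁ < r₂ → (lawBW (MeasureTheory.volume : MeasureTheory.Measure ℂ)).real (Arm r₁ r₂) ≤ Ca * (r₁ / r₂) ^ η + v) → (lawBW (MeasureTheory.volume : MeasureTheory.Measure ℂ)).real (stepBad T u R W g V δ K i ∩ good) ≤ 3 * p * ((Ca + v + 1) ^ 2 * ((400 * u / R) ^ η + v)) + (2 * (R + 2 * u) / u + 1) ^ 2 * p ^ 2 * ((Ca + v + 1) ^ 2 * ((400 * u / R) ^ η + v)) + ((2 * (R + 2 * u) / u + 1) ^ 2) ^ 2 *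 p ^ 3 := by
  intro T u R ρD p v Ca η W g V δ K good DefLoc ADef Arm AArm i hu hR hρD hρD10 hp hv hCa hη hi
    hDef hArm hDefLoc hArmLoc hpB haB
  exact stepBad_measure_le_R T u R ρD p v Ca η W g V δ K good DefLoc ADef Arm AArm i hu hR hρD
    hρD10 hp hv hCa hη hi hDef (fun r₁ r₂ h₁ h₂ _ => hArm r₁ r₂ h₁ h₂) hDefLoc hArmLoc hpB
    fun r₁ r₂ h₁ h₂ _ => haB r₁ r₂ h₁ h₂

end Summit.CriticalPhenomena.CardyFormulaZ2.Cruxes.VoronoiHubFromSmirnov.MoebiusExactDelaunayDilationWard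

end
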